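import Mathlib
import Literature.AlgebraicGeometry.Resolution.WeightedQuasiRegularGeneral
import HarnessLib

/-!
# Weighted initial terms and the Newton point set of an ideal (expansion-free)

Topic: `Literature/AlgebraicGeometry/Resolution`. Foundations for Hironaka's characteristic
polygon `Δ(J; u₁, u₂; y)` of an ideal `J` of a regular local ring `R` of dimension `3` with
respect to a regular system of parameters `c = (c₀, c₁, c₂) = (y, u₁, u₂)` — in the
expansion-free form needed for arbitrary (possibly mixed-characteristic) regular local rings,
where no coefficient field is available (Cossart–Jannsen–Saito, LNM 2270, Ch. 7–8: expansions
`f = Σ C_{A,B} y^B u^A` with `C_{A,B} ∈ R^× ∪ {0}`, Definition 8.2: "`Δ(g, y, u)` does not depend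
on the presentation"). We replace presentations by:

* **unit representatives** (`exists_unitRep`): every `f ∈ R` is, modulo `𝔪^N`, a polynomial
  `F(c)` all of whose coefficients are UNITS (CJS (7.3) truncated);
* the **weighted quasi-regularity** of `R` (`coeff_mem_maximalIdeal_of_weval_mem_general`,
  `WeightedQuasiRegularGeneral.lean`), which makes the lowest-weight part of a unit
  representative canonical: `mem_weightedIdealW_iff_of_unitRep` (membership of `f` in the
  weighted order ideals `F^{(w)}_ρ = (c^e : ⟨w, e⟩ ≥ ρ)` is read off ANY unit representative);
* **initial unit terms** (`IsInitialTerm c w f e`: `f ≡ F(c) mod F^{(w)}_{⟨w,e⟩+1}` with `F`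
  `w`-homogeneous of weight `⟨w, e⟩` and `coeff_e F` a unit) — canonical
  (`isInitialTerm_iff_of_unitRep`), and the **Newton point set**
  `occ c J = {e | e is a w-initial unit term of some f ∈ J for some positive weight w}`;
* ★ `le_weightedIdealW_iff_forall_occ`: for positive weights `w` and any ideal `J`,
  `J ⊆ F^{(w)}_ρ ⟺ ∀ e ∈ occ c J, ρ ≤ ⟨w, e⟩` — the polygon of `J` is cut out by its Newton
  points, and conversely (CJS Remark 8.9 (2): "`Δ(f, y, u)` is defined by equations
  `L₁(A) ≥ d₁, …, L_t(A) ≥ d_t`"; Cossart–Piltant 2008, p. 10: the set `E` of exponents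
  `(c/i, d/i)` of `J R̂`).

Everything is PROVED; no facts. Used by the polygon invariants `α, β, δ, γ±, ε, ζ`
(CJS Definition 11.1) of the idealistic exponent `(J, μ)` in the proof of Cossart–Piltant 2008
Lemma 4.5 / Proposition 4.4 (towards `CossartPiltant2019Principalization`).

## Sources

* V. Cossart, U. Jannsen, S. Saito, *Desingularization: Invariants and Strategy*, LNM 2270
  (2020), Ch. 7 (7.3), (7.4); Ch. 8, Def. 8.2, Lemma 8.3, Remark 8.9. [CossartJannsenSaito2020]
* V. Cossart, O. Piltant, J. Algebra 320 (2008), §4, p. 10 (the set `E`). [CossartPiltant2008]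
* H. Hironaka, *Characteristic polyhedra of singularities*, J. Math. Kyoto Univ. 7 (1967), §1.
  [Hironaka1967]
-/

noncomputable section

open IsLocalRing MvPolynomial

namespace Literature.AlgebraicGeometry.Resolution

universe u

variable {R : Type u} [CommRing R]

/-! ## Generalities on the weighted order ideals -/

/-- `Set.range c = {c 0, c 1, c 2}` for a triple. [folklore] -/
theorem range_fin_three {α : Type*} (c : Fin 3 → α) : Set.range c = {c 0, c 1, c 2} := by
  ext x
  simp only [Set.mem_range, Set.mem_insert_iff, Set.mem_singleton_iff]
  constructor
  · rintro ⟨i, rfl⟩; fin_cases i <;> simp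
  · rintro (rfl | rfl | rfl) <;> exact ⟨_, rfl⟩

/-- `F^{(w)}_0 = R`. [folklore] -/
theorem weightedIdealW_zero (c : Fin 3 → R) (w : Fin 3 → ℕ) : weightedIdealW c w 0 = ⊤ := by
  rw [eq_top_iff]
  intro f _
  have h1 : (1 : R) ∈ weightedIdealW c w 0 := by
    have := monomial_mem_weightedIdealW c w (ρ := 0) (e := 0) (by simp)
    simpa [monom3] using this
  simpa using Ideal.mul_mem_left _ f h1

/-- `𝔪^N ⊆ F^{(w)}_N` for positive weights. [folklore] -/
theorem pow_maximalIdeal_le_weightedIdealW [IsLocalRing R] (c : Fin 3 → R)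
    (hgen : Ideal.span (Set.range c) = maximalIdeal R) {w : Fin 3 → ℕ} (hw : ∀ i, 0 < w i)
    (N : ℕ) : maximalIdeal R ^ N ≤ weightedIdealW c w N := by
  induction N with
  | zero => rw [weightedIdealW_zero]; exact le_top
  | succ N ih =>
    rw [pow_succ, mul_comm]
    exact (Ideal.mul_mono_right ih).trans (maximalIdeal_mul_weightedIdealW_le c w hw hgen N)

/-- `F^{(1,1,1)}_N = 𝔪^N`. [folklore] -/
theorem weightedIdealW_one_eq_pow [IsLocalRing R] (c : Fin 3 → R)
    (hgen : Ideal.span (Set.range c) = maximalIdeal R) (N : ℕ) :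
    weightedIdealW c (fun _ => 1) N = maximalIdeal R ^ N := by
  refine le_antisymm ?_ (pow_maximalIdeal_le_weightedIdealW c hgen (fun _ => Nat.one_pos) N)
  rw [weightedIdealW, Ideal.span_le]
  rintro _ ⟨e, he, rfl⟩
  have hci : ∀ i, c i ∈ maximalIdeal R := fun i => by
    rw [← hgen]; exact Ideal.subset_span ⟨i, rfl⟩
  have hmem : monom3 c e ∈ maximalIdeal R ^ (e 0 + e 1 + e 2) := by
    rw [pow_add, pow_add, monom3]
    exact Ideal.mul_mem_mul (Ideal.mul_mem_mul (Ideal.pow_mem_pow (hci 0) _)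
      (Ideal.pow_mem_pow (hci 1) _)) (Ideal.pow_mem_pow (hci 2) _)
  have hwt : Finsupp.weight (fun _ : Fin 3 => (1 : ℕ)) e = e 0 + e 1 + e 2 := by
    rw [Finsupp.weight_apply, Finsupp.sum_fintype _ _ (by simp)]
    simp [Fin.sum_univ_three]
  rw [hwt] at he
  exact Ideal.pow_le_pow_right he hmem

/-- The weight of `e` for the weight vector `(1,1,1)` is `e 0 + e 1 + e 2`. [folklore] -/
theorem weight_one_eq (e : Fin 3 →₀ ℕ) :
    Finsupp.weight (fun _ : Fin 3 => (1 : ℕ)) e = e 0 + e 1 + e 2 := by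
  rw [Finsupp.weight_apply, Finsupp.sum_fintype _ _ (by simp)]
  simp [Fin.sum_univ_three]

/-! ## Unit representatives (CJS (7.3), truncated) -/

/-- A polynomial all of whose (nonzero) coefficients are units. [cite: CossartJannsenSaito2020, Ch. 7 (7.3)] -/
def HasUnitCoeffs (F : MvPolynomial (Fin 3) R) : Prop := ∀ m ∈ F.support, IsUnit (F.coeff m)

/-- `0` has unit coefficients (vacuously). [folklore] -/
theorem hasUnitCoeffs_zero : HasUnitCoeffs (0 : MvPolynomial (Fin 3) R) := by
  intro m hm; simp at hm

/-- A weighted homogeneous component of a polynomial with unit coefficients has unit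
coefficients. [folklore] -/
theorem HasUnitCoeffs.weightedHomogeneousComponent {F : MvPolynomial (Fin 3) R}
    (hF : HasUnitCoeffs F) (w : Fin 3 → ℕ) (n : ℕ) :
    HasUnitCoeffs (weightedHomogeneousComponent w n F) := by
  classical
  intro m hm
  rw [mem_support_iff, coeff_weightedHomogeneousComponent] at hm
  rw [coeff_weightedHomogeneousComponent]
  split_ifs with h
  · rw [if_pos h] at hm
    exact hF m (mem_support_iff.mpr hm)
  · rw [if_neg h] at hm; exact absurd rfl hm

/-- **Unit representatives**: every `f ∈ R` is congruent modulo `𝔪^N` to `F(c)` for a polynomial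
`F` with unit coefficients supported in degrees `< N`. [cite: CossartJannsenSaito2020, Ch. 7 (7.3)] -/
theorem exists_unitRep [IsLocalRing R] (c : Fin 3 → R)
    (hgen : Ideal.span (Set.range c) = maximalIdeal R) (f : R) (N : ℕ) :
    ∃ F : MvPolynomial (Fin 3) R, HasUnitCoeffs F ∧ (∀ m ∈ F.support, m.degree < N) ∧
      f - eval c F ∈ maximalIdeal R ^ N := by
  classical
  induction N with
  | zero => exact ⟨0, hasUnitCoeffs_zero, by simp, by simp⟩
  | succ N ih =>
    obtain ⟨F, hFu, hFdeg, hFrem⟩ := ih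
    set r := f - eval c F with hr
    have hr1 : r ∈ weightedIdealW c (fun _ => 1) N := by
      rw [weightedIdealW_one_eq_pow c hgen]; exact hFrem
    obtain ⟨P, hP, hPr⟩ := (mem_weightedIdealW_iff_exists_mvPolynomial c _ N r).mp hr1
    set PN := weightedHomogeneousComponent (fun _ : Fin 3 => (1 : ℕ)) N P with hPN
    -- the unit part of `PN`
    set U : MvPolynomial (Fin 3) R :=
      ∑ m ∈ PN.support.filter (fun m => IsUnit (PN.coeff m)), monomial m (PN.coeff m) with hU
    have hUcoeff : ∀ m, U.coeff m = if m ∈ PN.support ∧ IsUnit (PN.coeff m) then PN.coeff m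
        else 0 := by
      intro m
      rw [hU, coeff_sum]
      split_ifs with h
      · rw [Finset.sum_eq_single m]
        · rw [coeff_monomial, if_pos rfl]
        · intro m' _ hne; rw [coeff_monomial, if_neg hne]
        · intro hm; exact absurd (Finset.mem_filter.mpr h) hm
      · refine Finset.sum_eq_zero fun m' hm' => ?_
        rw [coeff_monomial, if_neg]
        rintro rfl
        exact h (Finset.mem_filter.mp hm')
    have hUsupp : ∀ m ∈ U.support, m ∈ PN.support ∧ IsUnit (PN.coeff m) := by
      intro m hm
      rw [mem_support_iff, hUcoeff] at hm
      by_contra h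
      rw [if_neg h] at hm
      exact hm rfl
    have hPNdeg : ∀ m ∈ PN.support, m.degree = N := by
      intro m hm
      have := weightedHomogeneousComponent_isWeightedHomogeneous N P (mem_support_iff.mp hm)
      rw [weight_one_eq] at this
      rw [← this, Finsupp.degree_eq_sum, Fin.sum_univ_three]
    have hFdeg' : ∀ m ∈ F.support, m.degree ≠ N := fun m hm => (hFdeg m hm).ne
    -- new representative
    refine ⟨F + U, ?_, ?_, ?_⟩
    · intro m hm
      rw [coeff_add]
      by_cases hmU : m ∈ U.support
      · obtain ⟨hmPN, hunit⟩ := hUsupp m hmU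
        have hmF : F.coeff m = 0 := by
          by_contra h
          exact hFdeg' m (mem_support_iff.mpr h) (hPNdeg m hmPN)
        rw [hmF, zero_add, hUcoeff, if_pos ⟨hmPN, hunit⟩]
        exact hunit
      · rw [notMem_support_iff.mp hmU, add_zero]
        have hmF : m ∈ F.support := by
          rcases Finset.mem_union.mp (support_add hm) with h | h
          · exact h
          · exact absurd h hmU
        exact hFu m hmF
    · intro m hm
      rcases Finset.mem_union.mp (support_add hm) with h | h
      · exact (hFdeg m h).trans (Nat.lt_succ_self N)
      · rw [hPNdeg m (hUsupp m h).1]; exact Nat.lt_succ_self N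
    · -- `f - (F + U)(c) = (P - PN)(c) + (PN - U)(c)`
      have hsplit : f - eval c (F + U) = eval c (P - PN) + eval c (PN - U) := by
        rw [map_add, map_sub, map_sub, hPr, hr]; ring
      rw [hsplit]
      refine Ideal.add_mem _ ?_ ?_
      · -- higher-degree part
        rw [← weightedIdealW_one_eq_pow c hgen]
        refine (mem_weightedIdealW_iff_exists_mvPolynomial c _ (N + 1) _).mpr
          ⟨P - PN, fun m hm => ?_, rfl⟩
        rw [mem_support_iff, coeff_sub, hPN, coeff_weightedHomogeneousComponent] at hm
        by_cases hwt : Finsupp.weight (fun _ : Fin 3 => (1 : ℕ)) m = N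
        · rw [if_pos hwt, sub_self] at hm; exact absurd rfl hm
        · rw [if_neg hwt, sub_zero] at hm
          have := hP m (mem_support_iff.mpr hm)
          omega
      · -- the non-unit coefficients of `PN` lie in `𝔪`
        have hci : ∀ i, c i ∈ maximalIdeal R := fun i => by
          rw [← hgen]; exact Ideal.subset_span ⟨i, rfl⟩
        rw [(PN - U).as_sum, map_sum]
        refine Ideal.sum_mem _ fun m hm => ?_
        rw [eval_monomial_eq_monom3, coeff_sub]
        have hmPN : m ∈ PN.support := by
          rcases Finset.mem_union.mp (support_sub _ PN U hm) with h | h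
          · exact h
          · exact (hUsupp m h).1
        by_cases hunit : IsUnit (PN.coeff m)
        · rw [hUcoeff, if_pos ⟨hmPN, hunit⟩, sub_self, zero_mul]; exact Ideal.zero_mem _
        · rw [hUcoeff, if_neg (fun h => hunit h.2), sub_zero]
          have hcm : PN.coeff m ∈ maximalIdeal R := (mem_maximalIdeal _).mpr hunit
          have hmono : monom3 c m ∈ maximalIdeal R ^ N := by
            have hmem : monom3 c m ∈ maximalIdeal R ^ (m 0 + m 1 + m 2) := by
              rw [pow_add, pow_add, monom3]
              exact Ideal.mul_mem_mul (Ideal.mul_mem_mul (Ideal.pow_mem_pow (hci 0) _)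
                (Ideal.pow_mem_pow (hci 1) _)) (Ideal.pow_mem_pow (hci 2) _)
            have hdeg := hPNdeg m hmPN
            rw [Finsupp.degree_eq_sum, Fin.sum_univ_three] at hdeg
            rwa [hdeg] at hmem
          rw [pow_succ, mul_comm (maximalIdeal R ^ N)]
          exact Ideal.mul_mem_mul hcm hmono

/-- Unit representatives modulo a weighted order ideal: for positive weights, every `f` is
congruent modulo `F^{(w)}_M` to `F(c)` with `F` of unit coefficients. [cite: CossartJannsenSaito2020, Ch. 7 (7.3)] -/
theorem exists_unitRep_weighted [IsLocalRing R] (c : Fin 3 → R)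
    (hgen : Ideal.span (Set.range c) = maximalIdeal R) {w : Fin 3 → ℕ} (hw : ∀ i, 0 < w i)
    (f : R) (M : ℕ) :
    ∃ F : MvPolynomial (Fin 3) R, HasUnitCoeffs F ∧ (∀ m ∈ F.support, m.degree < M) ∧
      f - eval c F ∈ weightedIdealW c w M := by
  obtain ⟨F, hFu, hFdeg, hFrem⟩ := exists_unitRep c hgen f M
  exact ⟨F, hFu, hFdeg, pow_maximalIdeal_le_weightedIdealW c hgen hw M hFrem⟩

/-! ## Initial unit terms and Newton points: definitions -/

/-- The `range` form of the generation hypothesis. [folklore] -/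
theorem span_range_eq_of_span_triple [IsLocalRing R] (c : Fin 3 → R)
    (hgen : Ideal.span {c 0, c 1, c 2} = maximalIdeal R) :
    Ideal.span (Set.range c) = maximalIdeal R := by
  rw [range_fin_three]; exact hgen

/-- The evaluation of a polynomial all of whose monomials have weight `≥ ρ` lies in `F_ρ`.
[folklore] -/
theorem eval_mem_weightedIdealW_of_forall_le (c : Fin 3 → R) (w : Fin 3 → ℕ) {ρ : ℕ}
    {F : MvPolynomial (Fin 3) R} (hF : ∀ m ∈ F.support, ρ ≤ Finsupp.weight w m) :
    eval c F ∈ weightedIdealW c w ρ :=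
  (mem_weightedIdealW_iff_exists_mvPolynomial c w ρ _).mpr ⟨F, hF, rfl⟩

/-- The part of `F` of weight `≠ n` above the minimum weight `n` of `F` evaluates into
`F_{n+1}`. [folklore] -/
theorem eval_sub_component_mem (c : Fin 3 → R) (w : Fin 3 → ℕ) {n : ℕ}
    {F : MvPolynomial (Fin 3) R} (hmin : ∀ m ∈ F.support, n ≤ Finsupp.weight w m) :
    eval c (F - weightedHomogeneousComponent w n F) ∈ weightedIdealW c w (n + 1) := by
  classical
  refine eval_mem_weightedIdealW_of_forall_le c w fun m hm => ?_
  rw [mem_support_iff, coeff_sub, coeff_weightedHomogeneousComponent] at hm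
  by_cases hwt : Finsupp.weight w m = n
  · rw [if_pos hwt, sub_self] at hm; exact absurd rfl hm
  · rw [if_neg hwt, sub_zero] at hm
    have := hmin m (mem_support_iff.mpr hm)
    omega

/-- The difference of two `w`-homogeneous polynomials of the same weight is `w`-homogeneous.
[folklore] -/
theorem isWeightedHomogeneous_sub {w : Fin 3 → ℕ} {n : ℕ} {F G : MvPolynomial (Fin 3) R}
    (hF : F.IsWeightedHomogeneous w n) (hG : G.IsWeightedHomogeneous w n) :
    (F - G).IsWeightedHomogeneous w n := by
  intro d hd
  rw [coeff_sub] at hd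
  by_cases hFd : F.coeff d = 0
  · have hGd : G.coeff d ≠ 0 := by
      intro h; rw [hFd, h, sub_zero] at hd; exact hd rfl
    exact hG hGd
  · exact hF hFd

/-- **`e` is a `w`-initial unit term of `f`**: `f ≡ F(c) mod F^{(w)}_{⟨w,e⟩+1}` for some
`w`-homogeneous `F` of weight `⟨w, e⟩` whose coefficient at `e` is a unit — the expansion-free
form of "`C_{A,B} ≠ 0` and `L(A,B)` minimal" for the term `y^B u^A` of a presentation (7.3)
(CJS Definition 8.2 (2), the `v`-initial `in_v(g)`). [cite: CossartJannsenSaito2020, Def. 8.2] -/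
def IsInitialTerm (c : Fin 3 → R) (w : Fin 3 → ℕ) (f : R) (e : Fin 3 →₀ ℕ) : Prop :=
  ∃ F : MvPolynomial (Fin 3) R, F.IsWeightedHomogeneous w (Finsupp.weight w e) ∧
    IsUnit (F.coeff e) ∧ f - eval c F ∈ weightedIdealW c w (Finsupp.weight w e + 1)

/-- An element with an initial term of weight `n` lies in `F_n`. [folklore] -/
theorem IsInitialTerm.mem (c : Fin 3 → R) {w : Fin 3 → ℕ} {f : R} {e : Fin 3 →₀ ℕ}
    (h : IsInitialTerm c w f e) : f ∈ weightedIdealW c w (Finsupp.weight w e) := by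
  obtain ⟨F, hF, -, hrem⟩ := h
  have h1 : eval c F ∈ weightedIdealW c w (Finsupp.weight w e) :=
    eval_mem_weightedIdealW_of_forall_le c w fun m hm => (hF (mem_support_iff.mp hm)).ge
  have h2 := weightedIdealW_antitone c w (Nat.le_succ _) hrem
  have : f = f - eval c F + eval c F := by ring
  rw [this]; exact Ideal.add_mem _ h2 h1

/-- In a local ring, `unit + element of 𝔪` is a unit. [folklore] -/
theorem isUnit_add_of_mem_maximalIdeal [IsLocalRing R] {a b : R} (ha : IsUnit a)
    (hb : b ∈ maximalIdeal R) : IsUnit (a + b) := by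
  by_contra h
  have hab : a + b ∈ maximalIdeal R := (mem_maximalIdeal _).mpr h
  have : a ∈ maximalIdeal R := by
    have := Ideal.sub_mem _ hab hb
    rwa [add_sub_cancel_right] at this
  exact (mem_maximalIdeal _).mp this ha

/-- **The Newton point set** of `J` with respect to `c`: the exponents which are `w`-initial unit
terms of some element of `J` for some positive weight `w` (the essential points `Ṽ(f, y, u)` of
CJS Definition 8.5 (4), for all elements of `J` at once; Cossart–Piltant's set `E`, before
normalising by `μ − |B|`). [cite: CossartJannsenSaito2020, Def. 8.5 (4)] [cite: CossartPiltant2008, §4 p. 10] -/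
def occ (c : Fin 3 → R) (J : Ideal R) : Set (Fin 3 →₀ ℕ) :=
  {e | ∃ f ∈ J, ∃ w : Fin 3 → ℕ, (∀ i, 0 < w i) ∧ IsInitialTerm c w f e}

/-- `occ` is monotone in the ideal. [folklore] -/
theorem occ_mono (c : Fin 3 → R) {J J' : Ideal R} (h : J ≤ J') : occ c J ⊆ occ c J' := by
  rintro e ⟨f, hf, w, hw, he⟩; exact ⟨f, h hf, w, hw, he⟩

/-- Initial terms of members are Newton points. [folklore] -/
theorem mem_occ_of_isInitialTerm (c : Fin 3 → R) {J : Ideal R} {f : R} (hf : f ∈ J)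
    {w : Fin 3 → ℕ} (hw : ∀ i, 0 < w i) {e : Fin 3 →₀ ℕ} (he : IsInitialTerm c w f e) :
    e ∈ occ c J :=
  ⟨f, hf, w, hw, he⟩

/-- Initial terms of generators are Newton points of the generated ideal. [folklore] -/
theorem mem_occ_span_of_isInitialTerm (c : Fin 3 → R) {S : Set R} {f : R} (hf : f ∈ S)
    {w : Fin 3 → ℕ} (hw : ∀ i, 0 < w i) {e : Fin 3 →₀ ℕ} (he : IsInitialTerm c w f e) :
    e ∈ occ c (Ideal.span S) :=
  ⟨f, Ideal.subset_span hf, w, hw, he⟩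

/-! ## Reading weighted orders off a unit representative -/

section Regular

variable [IsRegularLocalRing R] (c : Fin 3 → R)
  (hgen : Ideal.span {c 0, c 1, c 2} = maximalIdeal R) (hdim : ringKrullDim R = 3)

include hgen hdim in
/-- **Weighted quasi-regularity, unit form**: a `w`-homogeneous polynomial of weight `n` with a
UNIT coefficient does not evaluate into `F^{(w)}_{n+1}` (positive weights).
[cite: CossartJannsenSaito2020, Lemma 8.3 (1)] [cite: Hironaka1967, §1] -/
theorem eval_not_mem_of_isUnit_coeff {w : Fin 3 → ℕ} (hw : ∀ i, 0 < w i) {n : ℕ}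
    {F : MvPolynomial (Fin 3) R} (hF : F.IsWeightedHomogeneous w n) {e : Fin 3 →₀ ℕ}
    (he : IsUnit (F.coeff e)) : eval c F ∉ weightedIdealW c w (n + 1) := by
  intro h
  have hsupp : ∀ m ∈ F.support, Finsupp.weight w m = n := fun m hm =>
    hF (mem_support_iff.mp hm)
  have hc := coeff_mem_maximalIdeal_of_weval_mem_general c hgen hdim w hw hsupp h e
  exact (mem_maximalIdeal _).mp hc he

include hgen hdim in
/-- **Membership in the weighted order ideals is read off any unit representative**: if
`f ≡ F(c) mod F_M` with `F` of unit coefficients, then for `ρ ≤ M`,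
`f ∈ F_ρ ⟺ every monomial of F has weight ≥ ρ` (positive weights).
[cite: CossartJannsenSaito2020, Lemma 8.3 (1)] -/
theorem mem_weightedIdealW_iff_of_unitRep {w : Fin 3 → ℕ} (hw : ∀ i, 0 < w i) {f : R}
    {F : MvPolynomial (Fin 3) R} (hFu : HasUnitCoeffs F) {M : ℕ}
    (hrem : f - eval c F ∈ weightedIdealW c w M) {ρ : ℕ} (hρ : ρ ≤ M) :
    f ∈ weightedIdealW c w ρ ↔ ∀ m ∈ F.support, ρ ≤ Finsupp.weight w m := by
  classical
  constructor
  · intro hf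
    by_contra hne
    push Not at hne
    -- the minimal weight `n` over the support is `< ρ`
    have hsne : F.support.Nonempty := by
      obtain ⟨m, hm, -⟩ := hne; exact ⟨m, hm⟩
    set n := (F.support.image (Finsupp.weight w)).min' (hsne.image _) with hn
    have hnle : ∀ m ∈ F.support, n ≤ Finsupp.weight w m := fun m hm =>
      Finset.min'_le _ _ (Finset.mem_image_of_mem _ hm)
    obtain ⟨m₀, hm₀, hm₀n⟩ : ∃ m₀ ∈ F.support, Finsupp.weight w m₀ = n := by
      have := Finset.min'_mem _ (hsne.image (Finsupp.weight w))
      obtain ⟨m₀, hm₀, h⟩ := Finset.mem_image.mp this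
      exact ⟨m₀, hm₀, h⟩
    have hnρ : n < ρ := by
      obtain ⟨m, hm, hlt⟩ := hne
      exact (hnle m hm).trans_lt hlt
    set F₀ := weightedHomogeneousComponent w n F with hF₀
    have hF₀hom : F₀.IsWeightedHomogeneous w n := weightedHomogeneousComponent_isWeightedHomogeneous n F
    have hF₀e : IsUnit (F₀.coeff m₀) := by
      rw [hF₀, coeff_weightedHomogeneousComponent, if_pos hm₀n]; exact hFu m₀ hm₀
    -- `F₀(c) = f - (f - F(c)) - (F - F₀)(c) ∈ F_{n+1}`
    have hmem : eval c F₀ ∈ weightedIdealW c w (n + 1) := by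
      have h1 : f ∈ weightedIdealW c w (n + 1) := weightedIdealW_antitone c w hnρ hf
      have h2 : f - eval c F ∈ weightedIdealW c w (n + 1) :=
        weightedIdealW_antitone c w (by omega) hrem
      have h3 := eval_sub_component_mem c w hnle
      have : eval c F₀ = f - (f - eval c F) - eval c (F - F₀) := by rw [map_sub]; ring
      rw [this]
      exact Ideal.sub_mem _ (Ideal.sub_mem _ h1 h2) h3
    exact eval_not_mem_of_isUnit_coeff c hgen hdim hw hF₀hom hF₀e hmem
  · intro hall
    have h1 : eval c F ∈ weightedIdealW c w ρ := eval_mem_weightedIdealW_of_forall_le c w hall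
    have h2 : f - eval c F ∈ weightedIdealW c w ρ := weightedIdealW_antitone c w hρ hrem
    have : f = f - eval c F + eval c F := by ring
    rw [this]
    exact Ideal.add_mem _ h2 h1

include hgen hdim in
/-- An element with an initial term of weight `n` does not lie in `F_{n+1}` (positive
weights). [cite: CossartJannsenSaito2020, Lemma 8.3] -/
theorem IsInitialTerm.not_mem_succ {w : Fin 3 → ℕ} (hw : ∀ i, 0 < w i) {f : R}
    {e : Fin 3 →₀ ℕ} (h : IsInitialTerm c w f e) :
    f ∉ weightedIdealW c w (Finsupp.weight w e + 1) := by
  obtain ⟨F, hF, he, hrem⟩ := h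
  intro hf
  have : eval c F = f - (f - eval c F) := by ring
  refine eval_not_mem_of_isUnit_coeff c hgen hdim hw hF he ?_
  rw [this]; exact Ideal.sub_mem _ hf hrem

include hgen hdim in
/-- **Initial terms are canonical**: if `f ≡ F(c) mod F_M` with `F` of unit coefficients and
`⟨w, e⟩ < M`, then `e` is a `w`-initial unit term of `f` iff `e` is a monomial of `F` of minimal
weight (positive weights). [cite: CossartJannsenSaito2020, Lemma 8.3 (1)] -/
theorem isInitialTerm_iff_of_unitRep {w : Fin 3 → ℕ} (hw : ∀ i, 0 < w i) {f : R}
    {F : MvPolynomial (Fin 3) R} (hFu : HasUnitCoeffs F) {M : ℕ}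
    (hrem : f - eval c F ∈ weightedIdealW c w M) {e : Fin 3 →₀ ℕ}
    (heM : Finsupp.weight w e < M) :
    IsInitialTerm c w f e ↔ e ∈ F.support ∧ ∀ m ∈ F.support, Finsupp.weight w e ≤ Finsupp.weight w m := by
  classical
  set n := Finsupp.weight w e with hn
  constructor
  · intro h
    -- minimality of `n` over the support
    have hfn : f ∈ weightedIdealW c w n := h.mem c
    have hmin : ∀ m ∈ F.support, n ≤ Finsupp.weight w m :=
      (mem_weightedIdealW_iff_of_unitRep c hgen hdim hw hFu hrem heM.le).mp hfn
    refine ⟨?_, hmin⟩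
    obtain ⟨F₁, hF₁, he₁, hrem₁⟩ := h
    set F₀ := weightedHomogeneousComponent w n F with hF₀
    have hF₀hom : F₀.IsWeightedHomogeneous w n := weightedHomogeneousComponent_isWeightedHomogeneous n F
    -- `(F₁ - F₀)(c) ∈ F_{n+1}`
    have hdiff : eval c (F₁ - F₀) ∈ weightedIdealW c w (n + 1) := by
      have h3 := eval_sub_component_mem c w hmin
      have h2 : f - eval c F ∈ weightedIdealW c w (n + 1) :=
        weightedIdealW_antitone c w (by omega) hrem
      have : eval c (F₁ - F₀) = (f - eval c F) + eval c (F - F₀) - (f - eval c F₁) := by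
        rw [map_sub, map_sub]; ring
      rw [this]
      exact Ideal.sub_mem _ (Ideal.add_mem _ h2 h3) hrem₁
    have hhom : (F₁ - F₀).IsWeightedHomogeneous w n := isWeightedHomogeneous_sub hF₁ hF₀hom
    have hsupp : ∀ m ∈ (F₁ - F₀).support, Finsupp.weight w m = n := fun m hm =>
      hhom (mem_support_iff.mp hm)
    have hce : (F₁ - F₀).coeff e ∈ maximalIdeal R :=
      coeff_mem_maximalIdeal_of_weval_mem_general c hgen hdim w hw hsupp hdiff e
    have hF₀e : IsUnit (F₀.coeff e) := by
      have : F₀.coeff e = F₁.coeff e + (-(F₁ - F₀).coeff e) := by rw [coeff_sub]; ring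
      rw [this]
      exact isUnit_add_of_mem_maximalIdeal he₁ ((maximalIdeal R).neg_mem hce)
    rw [hF₀, coeff_weightedHomogeneousComponent, if_pos rfl] at hF₀e
    exact mem_support_iff.mpr hF₀e.ne_zero
  · rintro ⟨he, hmin⟩
    set F₀ := weightedHomogeneousComponent w n F with hF₀
    refine ⟨F₀, weightedHomogeneousComponent_isWeightedHomogeneous n F, ?_, ?_⟩
    · rw [hF₀, coeff_weightedHomogeneousComponent, if_pos rfl]; exact hFu e he
    · have h3 := eval_sub_component_mem c w hmin
      have h2 : f - eval c F ∈ weightedIdealW c w (n + 1) :=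
        weightedIdealW_antitone c w (by omega) hrem
      have : f - eval c F₀ = (f - eval c F) + eval c (F - F₀) := by rw [map_sub]; ring
      rw [this]; exact Ideal.add_mem _ h2 h3

include hgen hdim in
/-- **An initial term bounds every weighted order from above**: if `e` is a `w`-initial unit
term of `f` (`w` positive) and `f ∈ F^{(w′)}_ρ` for a positive weight `w′`, then `ρ ≤ ⟨w′, e⟩`
(the exponent `e` occurs with a unit coefficient in every fine enough unit representative of
`f`). [cite: CossartJannsenSaito2020, Remark 8.9 (2)] -/
theorem le_weight_of_isInitialTerm_of_mem {w w' : Fin 3 → ℕ} (hw : ∀ i, 0 < w i)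
    (hw' : ∀ i, 0 < w' i) {f : R} {e : Fin 3 →₀ ℕ} (he : IsInitialTerm c w f e) {ρ : ℕ}
    (hf : f ∈ weightedIdealW c w' ρ) : ρ ≤ Finsupp.weight w' e := by
  have hgenr := span_range_eq_of_span_triple c hgen
  set N := max (Finsupp.weight w e + 1) ρ with hN
  obtain ⟨F, hFu, -, hFrem⟩ := exists_unitRep c hgenr f N
  have hremw : f - eval c F ∈ weightedIdealW c w N :=
    pow_maximalIdeal_le_weightedIdealW c hgenr hw N hFrem
  have hremw' : f - eval c F ∈ weightedIdealW c w' N :=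
    pow_maximalIdeal_le_weightedIdealW c hgenr hw' N hFrem
  have heF : e ∈ F.support :=
    ((isInitialTerm_iff_of_unitRep c hgen hdim hw hFu hremw (by omega)).mp he).1
  exact (mem_weightedIdealW_iff_of_unitRep c hgen hdim hw' hFu hremw' (le_max_right _ _)).mp
    hf e heF

/-! ## The Newton point set of an ideal -/

include hgen hdim in
/-- **Non-membership is witnessed by an initial term**: if `f ∉ F^{(w)}_ρ` (`w` positive) then
`f` has a `w`-initial unit term of weight `< ρ`. [cite: CossartJannsenSaito2020, Lemma 8.3] -/
theorem exists_isInitialTerm_of_not_mem {w : Fin 3 → ℕ} (hw : ∀ i, 0 < w i) {f : R} {ρ : ℕ}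
    (hfρ : f ∉ weightedIdealW c w ρ) :
    ∃ e, IsInitialTerm c w f e ∧ Finsupp.weight w e < ρ := by
  classical
  have hgenr := span_range_eq_of_span_triple c hgen
  obtain ⟨F, hFu, -, hFrem⟩ := exists_unitRep_weighted c hgenr hw f ρ
  have hne : ¬ ∀ m ∈ F.support, ρ ≤ Finsupp.weight w m := fun h =>
    hfρ ((mem_weightedIdealW_iff_of_unitRep c hgen hdim hw hFu hFrem le_rfl).mpr h)
  push Not at hne
  have hsne : F.support.Nonempty := by
    obtain ⟨m, hm, -⟩ := hne; exact ⟨m, hm⟩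
  set n := (F.support.image (Finsupp.weight w)).min' (hsne.image _) with hn
  have hnle : ∀ m ∈ F.support, n ≤ Finsupp.weight w m := fun m hm =>
    Finset.min'_le _ _ (Finset.mem_image_of_mem _ hm)
  obtain ⟨m₀, hm₀, hm₀n⟩ : ∃ m₀ ∈ F.support, Finsupp.weight w m₀ = n := by
    have := Finset.min'_mem _ (hsne.image (Finsupp.weight w))
    obtain ⟨m₀, hm₀, h⟩ := Finset.mem_image.mp this
    exact ⟨m₀, hm₀, h⟩
  have hnρ : n < ρ := by
    obtain ⟨m, hm, hlt⟩ := hne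
    exact (hnle m hm).trans_lt hlt
  refine ⟨m₀, ?_, by omega⟩
  refine (isInitialTerm_iff_of_unitRep c hgen hdim hw hFu hFrem (by omega)).mpr ⟨hm₀, ?_⟩
  intro m hm; rw [hm₀n]; exact hnle m hm

include hgen hdim in
/-- Elementwise ★: `f ∈ F^{(w)}_ρ ⟺` every `w`-initial unit term `e` of `f` has `⟨w, e⟩ ≥ ρ`
(`w` positive). [cite: CossartJannsenSaito2020, Remark 8.9 (2)] -/
theorem mem_weightedIdealW_iff_forall_isInitialTerm {w : Fin 3 → ℕ} (hw : ∀ i, 0 < w i)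
    (f : R) (ρ : ℕ) :
    f ∈ weightedIdealW c w ρ ↔ ∀ e, IsInitialTerm c w f e → ρ ≤ Finsupp.weight w e := by
  constructor
  · intro hf e he
    exact le_weight_of_isInitialTerm_of_mem c hgen hdim hw hw he hf
  · intro h
    by_contra hf
    obtain ⟨e, he, hlt⟩ := exists_isInitialTerm_of_not_mem c hgen hdim hw hf
    have := h e he
    omega

include hgen hdim in
/-- ★ **The weighted order ideals containing `J` are determined by its Newton points, and
conversely**: for a positive weight `w`, `J ⊆ F^{(w)}_ρ ⟺ ∀ e ∈ occ c J, ρ ≤ ⟨w, e⟩`.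
[cite: CossartJannsenSaito2020, Remark 8.9 (2)] [cite: CossartPiltant2008, §4 p. 10] -/
theorem le_weightedIdealW_iff_forall_occ {w : Fin 3 → ℕ} (hw : ∀ i, 0 < w i) (J : Ideal R)
    (ρ : ℕ) : J ≤ weightedIdealW c w ρ ↔ ∀ e ∈ occ c J, ρ ≤ Finsupp.weight w e := by
  constructor
  · rintro hJ e ⟨f, hf, w₀, hw₀, he⟩
    exact le_weight_of_isInitialTerm_of_mem c hgen hdim hw₀ hw he (hJ hf)
  · intro hall f hf
    by_contra hfρ
    obtain ⟨e, he, hlt⟩ := exists_isInitialTerm_of_not_mem c hgen hdim hw hfρ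
    have := hall e ⟨f, hf, w, hw, he⟩
    omega

include hgen hdim in
/-- Newton points of an ideal contained in `F^{(w′)}_ρ` have `w′`-weight `≥ ρ`; in particular
(weight `(1,1,1)`) the Newton points of `J ⊆ 𝔪^μ` have degree `≥ μ`. [folklore] -/
theorem le_degree_of_mem_occ {J : Ideal R} {μ : ℕ} (hJ : J ≤ maximalIdeal R ^ μ)
    {e : Fin 3 →₀ ℕ} (he : e ∈ occ c J) : μ ≤ e.degree := by
  have hgenr := span_range_eq_of_span_triple c hgen
  have hJ' : J ≤ weightedIdealW c (fun _ => 1) μ := by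
    rw [weightedIdealW_one_eq_pow c hgenr]; exact hJ
  have := (le_weightedIdealW_iff_forall_occ c hgen hdim (fun _ => Nat.one_pos) J μ).mp hJ' e he
  rw [weight_one_eq] at this
  rw [Finsupp.degree_eq_sum, Fin.sum_univ_three]
  exact this

include hgen hdim in
/-- ★ for a generating set: `span S ⊆ F^{(w)}_ρ ⟺` every `w`-initial term of every generator has
weight `≥ ρ` (`w` positive) — Newton conditions may be checked on generators.
[cite: CossartJannsenSaito2020, Remark 8.9 (2)] -/
theorem span_le_weightedIdealW_iff {w : Fin 3 → ℕ} (hw : ∀ i, 0 < w i) (S : Set R) (ρ : ℕ) :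
    Ideal.span S ≤ weightedIdealW c w ρ ↔
      ∀ f ∈ S, ∀ e, IsInitialTerm c w f e → ρ ≤ Finsupp.weight w e := by
  rw [Ideal.span_le]
  constructor
  · intro h f hf e he
    exact (mem_weightedIdealW_iff_forall_isInitialTerm c hgen hdim hw f ρ).mp (h hf) e he
  · intro h f hf
    exact (mem_weightedIdealW_iff_forall_isInitialTerm c hgen hdim hw f ρ).mpr (h f hf)

end Regular

end Literature.AlgebraicGeometry.Resolution
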